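import Summits.QuantumFields.YangMills.Theorems.BalabanUVNodesN15KingModelHeatKernelGradientCycleL1
import Summits.QuantumFields.YangMills.Theorems.BalabanUVNodesN15KingModelHeatKernelGradientSubordination
import HarnessLib

/-!
# BalabanUVNodes ∕ N15 — THE KING-MODEL RUNG (PART ∇-k): THE ℓ¹ NORM OF THE LATTICE GRADIENT OF KING's `A = 0` COVARIANCE IS `O(√c∕m)` —
# `c·Σ_x|G(u+e_ν,x) − G(u,x)| ≤ 92016000·√(c∕m²)` on every cubic four-torus `(ℤ∕K₀)⁴`, every `c > 0`, `m² > 0`, `u`, `ν`; at King's scaling `c = L²`: `Σ_x|∇_uG(u,x)| ≤ 92016000∕(L·√m²)` — ONE POWER OF `η` (times the correlation length)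
# (the input of PART ∇-l: the extra `η` that makes the block correction of King's full propagator `O(η⁵)` under the lattice gradient, i.e. bounded in physical units)
# (Track A, DAG node N15 = NE2; FAN-OUT v1.1 §N15 s3 «KING-MODEL RUNG … + what the curved case adds»; count-neutral)

HONEST FRAMING.  Count-neutral (cell `pub-ymgap`, seat `pub-ymgap-dag-n15-e` g57; `--supports stmt-QuantumFields-27247 --as helper` = K3ᴬ).  King's `A = 0` comparison model, the fine covariance
`G = (c(−Δ)+m²)⁻¹` on the cubic four-torus; crude absolute constants (`92016000 = 3·142·60³`).  WHY: the pointwise law of PART ∇-f, `c|∇G(u,x)| ≤ C_∇∕(1+dist)³`, sums over the four-torus to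
`O(diameter)` — the inverse cube is not summable in four dimensions; the ℓ¹ norm of `∇G` is nevertheless `O(η)` because of the MASS: in continuum units `‖∇(−Δ+m²)⁻¹‖_{L¹} = O(1∕m)` and the
lattice gradient is `η·∂`.  THE MECHANISM: PART ∇-e's subordination bound summed over `x` and the sum pushed through the time integral; the `z`-sum of the differenced product FACTORISES over the
four coordinates (`Σ_zΠ_μf_μ(z_μ) = Π_μΣ_nf_μ(n)`) into PART ∇-j's one-dimensional ℓ¹ norms `(Σ_n‖∇Q_s(n)‖)·(Σ_n‖Q_s(n)‖)³ ≤ (142∕√s)·60³`; and `∫₀^∞e^{−μs}s^{−1∕2}ds ≤ 3∕√μ` (split at `s = 1∕μ`: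
`2√T` from PART ∇-e's singular integral, `T^{−1∕2}∕μ` from the tail), `μ = m²∕c`.
CONTENTS.  §1 `integrableOn_exp_neg_mul_inv_sqrt`, ★ `integral_exp_neg_mul_inv_sqrt_le` (`∫_{(0,∞)}e^{−μs}∕√s ≤ 3∕√μ`); §2 ★ `sum_gradProd_eq` (the factorisation), ★ `sum_gradProd_le` (`≤ 142·60³∕√s`);
§3 ★★★ **`mul_sum_abs_lapF_inv_grad_le`** (`c·Σ_x|G(u+e_ν,x)−G(u,x)| ≤ 92016000·√(c∕m²)`), ★★★ **`king_green_grad_rowSum_le`** (`Σ_x|∇_uG(u,x)| ≤ 92016000∕(L√m²)` on `(ℤ∕LM₀)⁴`, every `L`, `M₀`).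
PRIOR TREE ART (by name): ∇-e `mul_abs_lapF_inv_grad_le_integral` ∕ `integrableOn_gradMajorant_cM` ∕ `integral_Ioc_inv_sqrt` ∕ `integrableOn_inv_sqrt_Ioc`, Ϣ-h `setIntegral_Ioi_eq_Ioc_add_Ioi` ∕
`integral_Ioi_exp_neg_mul_le_inv`, ∇-j `sum_norm_cycleHeat_le` ∕ `sum_norm_cycleHeatGrad_le`; Mathlib `Fintype.prod_sum`, `MeasureTheory.integral_finsetSum`, `Equiv.subLeft`.
Dedup (rg at filing): basename 0 files; needles `mul_sum_abs_lapF_inv_grad_le|king_green_grad_rowSum_le|sum_gradProd_eq|integral_exp_neg_mul_inv_sqrt_le` 0 tree files.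
Locators: [King1986] (2.13) p.653, (4.4) p.670, (4.35) p.674, (3.63) p.663; [LawlerLimic2010] §2.3 ∕ Prop. 2.4.4.  0 `sorry`, 0 `def`.
-/

noncomputable section

open Real Set Finset MeasureTheory
open scoped BigOperators

namespace Summit.QuantumFields.YangMills.BalabanUVNodes.N15KingModelRung.HeatKernel

open Literature.MathematicalPhysics.QuantumFieldTheory.Balaban1983to89.B5Prop11Plancherel (Tor fine unitVec)
open Literature.MathematicalPhysics.QuantumFieldTheory.Balaban1983to89.Beta.WoodburyFibre (cM)
open Literature.MathematicalPhysics.QuantumFieldTheory.King1986.Torus (lapF)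

/-! ## §1 `∫₀^∞ e^{−μs} ds∕√s ≤ 3∕√μ` -/

/-- Continuity of `s ↦ e^{−μs}∕√s` at positive `s`. [folklore] -/
theorem continuousAt_exp_neg_mul_inv_sqrt (μ0 : ℝ) {s : ℝ} (hs : 0 < s) :
    ContinuousAt (fun s : ℝ => Real.exp (-(μ0 * s)) * (Real.sqrt s)⁻¹) s :=
  ((Real.continuous_exp.comp (by fun_prop : Continuous fun s : ℝ => -(μ0 * s))).continuousAt).mul
    (Real.continuous_sqrt.continuousAt.inv₀ (Real.sqrt_pos.mpr hs).ne')

/-- Integrability of `e^{−μs}∕√s` on `(0,∞)` for `μ > 0` (`≤ 1∕√s` near `0`, `≤ T^{−1∕2}e^{−μs}` beyond any `T > 0`). [folklore] -/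
theorem integrableOn_exp_neg_mul_inv_sqrt {μ0 : ℝ} (hμ : 0 < μ0) {T : ℝ} (hT : 0 < T) :
    IntegrableOn (fun s : ℝ => Real.exp (-(μ0 * s)) * (Real.sqrt s)⁻¹) (Ioc (0 : ℝ) T)
    ∧ IntegrableOn (fun s : ℝ => Real.exp (-(μ0 * s)) * (Real.sqrt s)⁻¹) (Ioi T) := by
  constructor
  · refine Integrable.mono' (integrableOn_inv_sqrt_Ioc T) ?_ ?_
    · exact ContinuousOn.aestronglyMeasurable (fun s hs => (continuousAt_exp_neg_mul_inv_sqrt μ0 hs.1).continuousWithinAt) measurableSet_Ioc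
    · refine (ae_restrict_iff' measurableSet_Ioc).mpr (Filter.Eventually.of_forall fun s hs => ?_)
      have he1 : Real.exp (-(μ0 * s)) ≤ 1 := by rw [Real.exp_le_one_iff]; exact neg_nonpos.mpr (by have := hs.1; positivity)
      rw [Real.norm_eq_abs, abs_of_nonneg (by positivity)]
      calc Real.exp (-(μ0 * s)) * (Real.sqrt s)⁻¹ ≤ 1 * (Real.sqrt s)⁻¹ := mul_le_mul_of_nonneg_right he1 (by positivity)
        _ = (Real.sqrt s)⁻¹ := one_mul _
  · have hE : IntegrableOn (fun s : ℝ => Real.exp (-(μ0 * s))) (Ioi T) := by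
      have := exp_neg_integrableOn_Ioi T hμ
      exact this.congr_fun (fun t _ => by ring_nf) measurableSet_Ioi
    refine Integrable.mono' (hE.const_mul (Real.sqrt T)⁻¹) ?_ ?_
    · exact ContinuousOn.aestronglyMeasurable (fun s hs => (continuousAt_exp_neg_mul_inv_sqrt μ0 (lt_trans hT hs)).continuousWithinAt) measurableSet_Ioi
    · refine (ae_restrict_iff' measurableSet_Ioi).mpr (Filter.Eventually.of_forall fun s hs => ?_)
      have hs0 : 0 < s := lt_trans hT hs
      have hsq : Real.sqrt T ≤ Real.sqrt s := Real.sqrt_le_sqrt (le_of_lt hs)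
      rw [Real.norm_eq_abs, abs_of_nonneg (by positivity), mul_comm]
      exact mul_le_mul_of_nonneg_right (inv_anti₀ (Real.sqrt_pos.mpr hT) hsq) (Real.exp_pos _).le

/-- ★ `∫_{(0,∞)} e^{−μs}∕√s ds ≤ 3∕√μ` for `μ > 0` (split at `T = 1∕μ`: `∫₀^T ds∕√s = 2√T = 2∕√μ`, `∫_T^∞e^{−μs}∕√s ≤ T^{−1∕2}∕μ = 1∕√μ`). [folklore] -/
theorem integral_exp_neg_mul_inv_sqrt_le {μ0 : ℝ} (hμ : 0 < μ0) :
    ∫ s in Ioi (0 : ℝ), Real.exp (-(μ0 * s)) * (Real.sqrt s)⁻¹ ≤ 3 / Real.sqrt μ0 := by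
  set T : ℝ := μ0⁻¹ with hT
  have hT0 : 0 < T := by positivity
  have hsμ : 0 < Real.sqrt μ0 := Real.sqrt_pos.mpr hμ
  have hsT : Real.sqrt T = (Real.sqrt μ0)⁻¹ := by rw [hT, Real.sqrt_inv]
  obtain ⟨hnear, hfar⟩ := integrableOn_exp_neg_mul_inv_sqrt hμ hT0
  have hI : IntegrableOn (fun s : ℝ => Real.exp (-(μ0 * s)) * (Real.sqrt s)⁻¹) (Ioi 0) := by
    rw [← Ioc_union_Ioi_eq_Ioi hT0.le]; exact hnear.union hfar
  rw [setIntegral_Ioi_eq_Ioc_add_Ioi hI hT0.le]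
  -- near piece
  have h1 : ∫ s in Ioc (0 : ℝ) T, Real.exp (-(μ0 * s)) * (Real.sqrt s)⁻¹ ≤ 2 / Real.sqrt μ0 := by
    have hpt : ∀ s ∈ Ioc (0 : ℝ) T, Real.exp (-(μ0 * s)) * (Real.sqrt s)⁻¹ ≤ (Real.sqrt s)⁻¹ := by
      intro s hs
      have he1 : Real.exp (-(μ0 * s)) ≤ 1 := by rw [Real.exp_le_one_iff]; exact neg_nonpos.mpr (by have := hs.1; positivity)
      calc Real.exp (-(μ0 * s)) * (Real.sqrt s)⁻¹ ≤ 1 * (Real.sqrt s)⁻¹ := mul_le_mul_of_nonneg_right he1 (by positivity)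
        _ = (Real.sqrt s)⁻¹ := one_mul _
    calc _ ≤ ∫ s in Ioc (0 : ℝ) T, (Real.sqrt s)⁻¹ := setIntegral_mono_on hnear (integrableOn_inv_sqrt_Ioc T) measurableSet_Ioc hpt
      _ = 2 * Real.sqrt T := integral_Ioc_inv_sqrt hT0
      _ = 2 / Real.sqrt μ0 := by rw [hsT, div_eq_mul_inv]
  -- far piece
  have h2 : ∫ s in Ioi T, Real.exp (-(μ0 * s)) * (Real.sqrt s)⁻¹ ≤ 1 / Real.sqrt μ0 := by
    have hE : IntegrableOn (fun s : ℝ => Real.exp (-(μ0 * s))) (Ioi T) := by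
      have := exp_neg_integrableOn_Ioi T hμ
      exact this.congr_fun (fun t _ => by ring_nf) measurableSet_Ioi
    have hpt : ∀ s ∈ Ioi T, Real.exp (-(μ0 * s)) * (Real.sqrt s)⁻¹ ≤ (Real.sqrt T)⁻¹ * Real.exp (-(μ0 * s)) := by
      intro s hs
      have hsq : Real.sqrt T ≤ Real.sqrt s := Real.sqrt_le_sqrt (le_of_lt hs)
      rw [mul_comm]
      exact mul_le_mul_of_nonneg_right (inv_anti₀ (Real.sqrt_pos.mpr hT0) hsq) (Real.exp_pos _).le
    calc _ ≤ ∫ s in Ioi T, (Real.sqrt T)⁻¹ * Real.exp (-(μ0 * s)) := setIntegral_mono_on hfar (hE.const_mul _) measurableSet_Ioi hpt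
      _ = (Real.sqrt T)⁻¹ * ∫ s in Ioi T, Real.exp (-(μ0 * s)) := integral_const_mul _ _
      _ ≤ (Real.sqrt T)⁻¹ * μ0⁻¹ := mul_le_mul_of_nonneg_left (integral_Ioi_exp_neg_mul_le_inv hμ hT0.le) (by positivity)
      _ = 1 / Real.sqrt μ0 := by
          rw [hsT, inv_inv]
          have hμs : μ0 = Real.sqrt μ0 * Real.sqrt μ0 := (Real.mul_self_sqrt hμ.le).symm
          field_simp
          nlinarith [hμs]
  calc _ ≤ 2 / Real.sqrt μ0 + 1 / Real.sqrt μ0 := add_le_add h1 h2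
    _ = 3 / Real.sqrt μ0 := by ring

/-! ## §2 The `z`-sum of the differenced product factorises -/

variable {K₀ : ℕ} [NeZero K₀]

/-- ★ FACTORISATION: `Σ_{z∈(ℤ∕K₀)⁴}‖∇Q_s(z_ν)‖·Π_{μ≠ν}‖Q_s(z_μ)‖ = (Σ_n‖∇Q_s(n)‖)·(Σ_n‖Q_s(n)‖)³`. [folklore] -/
theorem sum_gradProd_eq (s : ℝ) (ν : Fin 4) :
    ∑ z : Tor (cM K₀), ‖cycleHeatGrad K₀ s (z ν)‖ * ∏ μ ∈ Finset.univ.erase ν, ‖cycleHeat K₀ s (z μ)‖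
      = (∑ n : ZMod K₀, ‖cycleHeatGrad K₀ s n‖) * (∑ n : ZMod K₀, ‖cycleHeat K₀ s n‖) ^ 3 := by
  classical
  set f : (μ : Fin 4) → ZMod (cM K₀ μ) → ℝ := fun μ n => if μ = ν then ‖cycleHeatGrad K₀ s n‖ else ‖cycleHeat K₀ s n‖ with hf
  have h1 : ∀ z : Tor (cM K₀), ‖cycleHeatGrad K₀ s (z ν)‖ * ∏ μ ∈ Finset.univ.erase ν, ‖cycleHeat K₀ s (z μ)‖ = ∏ μ : Fin 4, f μ (z μ) := by
    intro z
    rw [← Finset.mul_prod_erase Finset.univ (fun μ => f μ (z μ)) (Finset.mem_univ ν)]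
    simp only [hf, if_true]
    congr 1
    exact Finset.prod_congr rfl fun μ hμ => by rw [if_neg (Finset.ne_of_mem_erase hμ)]
  simp_rw [h1]
  rw [← Fintype.prod_sum f, ← Finset.mul_prod_erase Finset.univ (fun μ => ∑ n, f μ n) (Finset.mem_univ ν)]
  simp only [hf, if_true]
  congr 1
  have hcard : (Finset.univ.erase ν).card = 3 := by rw [Finset.card_erase_of_mem (Finset.mem_univ ν), Finset.card_univ, Fintype.card_fin]
  rw [Finset.prod_congr rfl fun μ hμ => by rw [show (∑ n, f μ n) = ∑ n : ZMod K₀, ‖cycleHeat K₀ s n‖ from Finset.sum_congr rfl fun n _ => by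
      simp only [hf, if_neg (Finset.ne_of_mem_erase hμ)]]]
  rw [Finset.prod_const, hcard]

/-- ★ `Σ_z‖∇Q_s(z_ν)‖Π_{μ≠ν}‖Q_s(z_μ)‖ ≤ 142·60³∕√s` (`s > 0`; PART ∇-j). [cite: King1986, (4.4) p.670, (4.35) p.674] -/
theorem sum_gradProd_le {s : ℝ} (hs : 0 < s) (ν : Fin 4) :
    ∑ z : Tor (cM K₀), ‖cycleHeatGrad K₀ s (z ν)‖ * ∏ μ ∈ Finset.univ.erase ν, ‖cycleHeat K₀ s (z μ)‖ ≤ 142 * 60 ^ 3 / Real.sqrt s := by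
  rw [sum_gradProd_eq s ν]
  have h1 := sum_norm_cycleHeatGrad_le (K := K₀) hs
  have h2 := sum_norm_cycleHeat_le (K := K₀) hs
  have h20 : 0 ≤ ∑ n : ZMod K₀, ‖cycleHeat K₀ s n‖ := Finset.sum_nonneg fun n _ => norm_nonneg _
  have h3 : (∑ n : ZMod K₀, ‖cycleHeat K₀ s n‖) ^ 3 ≤ 60 ^ 3 := pow_le_pow_left₀ h20 h2 3
  calc _ ≤ (142 / Real.sqrt s) * 60 ^ 3 := mul_le_mul h1 h3 (by positivity) (by positivity)
    _ = 142 * 60 ^ 3 / Real.sqrt s := by ring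

/-! ## §3 The ℓ¹ norm of the lattice gradient -/

variable {c m2 : ℝ}

/-- ★★★ **THE ℓ¹ NORM OF THE LATTICE GRADIENT OF KING's COVARIANCE**: on the cubic four-torus `(ℤ∕K₀)⁴`, for every `c > 0`, `m² > 0`, `u`, `ν`:
`c·Σ_x|G(u+e_ν,x) − G(u,x)| ≤ 92016000·√(c∕m²)` — PART ∇-e's subordination bound summed over `x`, §2's factorisation, PART ∇-j's ℓ¹ norms and §1. [cite: King1986, (2.13) p.653, (4.4) p.670, (4.35) p.674, (3.63) p.663] -/
theorem mul_sum_abs_lapF_inv_grad_le (hc : 0 < c) (hm : 0 < m2) (u : Tor (cM K₀)) (ν : Fin 4) :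
    c * ∑ x : Tor (cM K₀), |(lapF (cM K₀) c m2)⁻¹ (u + unitVec (cM K₀) ν) x - (lapF (cM K₀) c m2)⁻¹ u x| ≤ 92016000 * Real.sqrt (c / m2) := by
  have hμ : 0 < m2 / c := div_pos hm hc
  set F : Tor (cM K₀) → ℝ → ℝ := fun z s => Real.exp (-(m2 / c * s)) * (‖cycleHeatGrad K₀ s (z ν)‖ * ∏ μ ∈ Finset.univ.erase ν, ‖cycleHeat K₀ s (z μ)‖) with hF
  have hpt : ∀ x : Tor (cM K₀), c * |(lapF (cM K₀) c m2)⁻¹ (u + unitVec (cM K₀) ν) x - (lapF (cM K₀) c m2)⁻¹ u x| ≤ ∫ s in Ioi (0 : ℝ), F (u - x) s :=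
    fun x => mul_abs_lapF_inv_grad_le_integral (cM K₀) hc hm u x ν
  have hint : ∀ z : Tor (cM K₀), IntegrableOn (F z) (Ioi 0) := fun z => integrableOn_gradMajorant_cM hc hm z ν
  -- the majorant of the summed integrand
  obtain ⟨hn1, hf1⟩ := integrableOn_exp_neg_mul_inv_sqrt hμ one_pos
  have hG : IntegrableOn (fun s : ℝ => Real.exp (-(m2 / c * s)) * (Real.sqrt s)⁻¹) (Ioi 0) := by
    rw [← Ioc_union_Ioi_eq_Ioi zero_le_one]; exact hn1.union hf1
  have hsum_int : IntegrableOn (fun s : ℝ => ∑ z : Tor (cM K₀), F z s) (Ioi 0) := integrable_finsetSum _ fun z _ => hint z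
  have hbound : ∀ s ∈ Ioi (0 : ℝ), ∑ z : Tor (cM K₀), F z s ≤ (142 * 60 ^ 3) * (Real.exp (-(m2 / c * s)) * (Real.sqrt s)⁻¹) := by
    intro s hs
    simp only [hF]
    rw [← Finset.mul_sum]
    calc Real.exp (-(m2 / c * s)) * ∑ z : Tor (cM K₀), ‖cycleHeatGrad K₀ s (z ν)‖ * ∏ μ ∈ Finset.univ.erase ν, ‖cycleHeat K₀ s (z μ)‖
        ≤ Real.exp (-(m2 / c * s)) * (142 * 60 ^ 3 / Real.sqrt s) := mul_le_mul_of_nonneg_left (sum_gradProd_le hs ν) (Real.exp_pos _).le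
      _ = (142 * 60 ^ 3) * (Real.exp (-(m2 / c * s)) * (Real.sqrt s)⁻¹) := by ring
  calc c * ∑ x : Tor (cM K₀), |(lapF (cM K₀) c m2)⁻¹ (u + unitVec (cM K₀) ν) x - (lapF (cM K₀) c m2)⁻¹ u x|
      = ∑ x : Tor (cM K₀), c * |(lapF (cM K₀) c m2)⁻¹ (u + unitVec (cM K₀) ν) x - (lapF (cM K₀) c m2)⁻¹ u x| := Finset.mul_sum _ _ _
    _ ≤ ∑ x : Tor (cM K₀), ∫ s in Ioi (0 : ℝ), F (u - x) s := Finset.sum_le_sum fun x _ => hpt x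
    _ = ∑ z : Tor (cM K₀), ∫ s in Ioi (0 : ℝ), F z s := Fintype.sum_equiv (Equiv.subLeft u) _ _ (fun x => rfl)
    _ = ∫ s in Ioi (0 : ℝ), ∑ z : Tor (cM K₀), F z s := (integral_finsetSum _ fun z _ => hint z).symm
    _ ≤ ∫ s in Ioi (0 : ℝ), (142 * 60 ^ 3) * (Real.exp (-(m2 / c * s)) * (Real.sqrt s)⁻¹) := setIntegral_mono_on hsum_int (hG.const_mul _) measurableSet_Ioi hbound
    _ = (142 * 60 ^ 3) * ∫ s in Ioi (0 : ℝ), Real.exp (-(m2 / c * s)) * (Real.sqrt s)⁻¹ := integral_const_mul _ _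
    _ ≤ (142 * 60 ^ 3) * (3 / Real.sqrt (m2 / c)) := mul_le_mul_of_nonneg_left (integral_exp_neg_mul_inv_sqrt_le hμ) (by norm_num)
    _ = 92016000 * Real.sqrt (c / m2) := by
        rw [Real.sqrt_div' m2 hc.le, Real.sqrt_div' c hm.le]
        field_simp
        norm_num

/-- ★★★ **AT KING's SCALING: THE ℓ¹ NORM OF `∇G` IS `O(η∕m)`**: on the fine four-torus `(ℤ∕LM₀)⁴` with `G = (L²(−Δ)+m²)⁻¹`, for EVERY `L ≥ 1`, EVERY volume `M₀ ≥ 1`, every `u`, `ν`: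
`Σ_x|G(u+e_ν,x) − G(u,x)| ≤ 92016000∕(L·√m²)` (compare the row sum `Σ_xG(u,x) = 1∕m²` exactly). [cite: King1986, (2.13) p.653, (2.16) p.653, (4.4) p.670, (3.63) p.663] -/
theorem king_green_grad_rowSum_le (L M₀ : ℕ) [NeZero L] [NeZero M₀] (hm : 0 < m2) (u : Tor (fine L (cM M₀))) (ν : Fin 4) :
    ∑ x : Tor (fine L (cM M₀)), |(lapF (fine L (cM M₀)) ((L : ℝ) ^ 2) m2)⁻¹ (u + unitVec (fine L (cM M₀)) ν) x - (lapF (fine L (cM M₀)) ((L : ℝ) ^ 2) m2)⁻¹ u x|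
      ≤ 92016000 / ((L : ℝ) * Real.sqrt m2) := by
  have hL : (0 : ℝ) < L := by exact_mod_cast Nat.pos_of_ne_zero (NeZero.ne L)
  have hc : (0 : ℝ) < (L : ℝ) ^ 2 := by positivity
  haveI : NeZero (L * M₀) := ⟨Nat.mul_ne_zero (NeZero.ne L) (NeZero.ne M₀)⟩
  have h := mul_sum_abs_lapF_inv_grad_le (K₀ := L * M₀) hc hm u ν
  have hsq : Real.sqrt ((L : ℝ) ^ 2 / m2) = (L : ℝ) / Real.sqrt m2 := by
    rw [Real.sqrt_div' _ hm.le, Real.sqrt_sq hL.le]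
  rw [hsq] at h
  rw [le_div_iff₀ (by positivity)]
  have hsm : 0 < Real.sqrt m2 := Real.sqrt_pos.mpr hm
  have e : 92016000 * ((L : ℝ) / Real.sqrt m2) * Real.sqrt m2 = 92016000 * L := by field_simp
  calc (∑ x : Tor (fine L (cM M₀)), |(lapF (fine L (cM M₀)) ((L : ℝ) ^ 2) m2)⁻¹ (u + unitVec (fine L (cM M₀)) ν) x - (lapF (fine L (cM M₀)) ((L : ℝ) ^ 2) m2)⁻¹ u x|) * ((L : ℝ) * Real.sqrt m2)
      = ((L : ℝ) ^ 2 * ∑ x : Tor (fine L (cM M₀)), |(lapF (fine L (cM M₀)) ((L : ℝ) ^ 2) m2)⁻¹ (u + unitVec (fine L (cM M₀)) ν) x - (lapF (fine L (cM M₀)) ((L : ℝ) ^ 2) m2)⁻¹ u x|)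
          * (Real.sqrt m2 / L) := by field_simp
    _ ≤ (92016000 * ((L : ℝ) / Real.sqrt m2)) * (Real.sqrt m2 / L) := mul_le_mul_of_nonneg_right h (by positivity)
    _ = 92016000 := by field_simp

end Summit.QuantumFields.YangMills.BalabanUVNodes.N15KingModelRung.HeatKernel

end
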